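import Mathlib
import Summits.NavierStokesRegularity.NavierStokesRegularity.Theorems.FilamentSkeletonRssAreaLawSlavingPackage

/-!
# Area-law slaving, part 10 — the slip hypotheses of the package PERSIST under `C¹`-small perturbations of the slip
# (`FilamentSkeletonRss`, child crux `TangentSkeletonNearStraight`, stmt-NavierStokesRegularity-28295, line
# `child_tangent_analytic_strip`; the step "the datum's quantitative margins persist" of the crux's mechanism sentence, for the area block)

The slaving package (`slavedArea_block`, part 5) consumes five hypotheses on a slip `w` with zero `c`: floor `m|τ − c| ≤ |w|`, core window
`w′ ≥ 3/2 + δ` on `|τ − c| ≤ S`, slope bound `|w′| ≤ Λ`, far barrier `|τ − c|/2 − C ≤ |w|`, and uniqueness of the zero.  Part 9 verified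
them for the zeroth iterate (rescaled straight datum).  This file shows they are OPEN conditions in the `C¹` topology, with explicit losses:
if `|w − w₀| ≤ η ≤ mS/8` and `|w′ − w₀′| ≤ η′ ≤ δ/2` everywhere, then `w` has a unique zero `c` with `|c − c₀| ≤ S/4` and satisfies the same
five hypotheses with constants `(min(m/4, 3/2), S/2, δ/2, Λ + η′, C + η + S/8)` (`slipHypotheses_persist`).  In the waist scaling of the
package (`S = σ₀√Γ`, `C = c₀√Γ`, `η = ε√Γ`) every loss is again of the form `const·√Γ` with a Γ-free constant, so the package applies along
any Newton/continuation path that stays `C¹`-close (in these units) to the zeroth iterate — `slavedArea_block_of_near` states exactly this.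

HONEST FRAMING: one-variable calculus (intermediate value theorem, monotonicity) serving a HYPOTHETICAL filament skeleton on the NEGATIVE side
of a MODEL route (A1G aside); nothing here bears on Navier–Stokes regularity or blow-up; no registered stub is closed.
`--supports stmt-NavierStokesRegularity-28295`.
-/

set_option linter.dupNamespace false

noncomputable section

namespace Summit.NavierStokesRegularity.NavierStokesRegularity.Theorems.AreaLawSlaving

open Set Real

/-! ## §1 Persistence of the five slip hypotheses -/

/-- Linear growth from a zero on a window of positive slope (two-sided): if `w(c) = 0` and `λ ≤ w′` on `|τ − c| ≤ r`, then
`λ|τ − c| ≤ |w(τ)|` for `|τ − c| ≤ r`. [folklore] -/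
theorem abs_slip_ge_linear {w : ℝ → ℝ} {c r lam : ℝ} (hw : Differentiable ℝ w) (hc : w c = 0)
    (hwin : ∀ τ, |τ - c| ≤ r → lam ≤ deriv w τ) {τ : ℝ} (hτ : |τ - c| ≤ r) : lam * |τ - c| ≤ |w τ| := by
  have hD : Convex ℝ (Icc (c - r) (c + r)) := convex_Icc _ _
  have hmvt := hD.mul_sub_le_image_sub_of_le_deriv hw.continuous.continuousOn
    (fun x _ => (hw x).differentiableWithinAt) (C := lam)
    (fun x hx => by
      rw [interior_Icc] at hx
      exact hwin x (abs_le.2 ⟨by linarith [hx.1], by linarith [hx.2]⟩))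
  have hτI : τ ∈ Icc (c - r) (c + r) := ⟨by linarith [(abs_le.1 hτ).1], by linarith [(abs_le.1 hτ).2]⟩
  have hr : 0 ≤ r := (abs_nonneg _).trans hτ
  have hcI : c ∈ Icc (c - r) (c + r) := ⟨by linarith, by linarith⟩
  rcases le_total c τ with h | h
  · have := hmvt c hcI τ hτI h
    rw [hc, sub_zero] at this
    rw [abs_of_nonneg (sub_nonneg.2 h)]
    exact this.trans (le_abs_self _)
  · have := hmvt τ hτI c hcI h
    rw [hc, zero_sub] at this
    rw [abs_of_nonpos (sub_nonpos.2 h), show lam * -(τ - c) = lam * (c - τ) by ring]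
    exact this.trans (neg_le_abs _)

/-- **PERSISTENCE OF THE SLIP HYPOTHESES.**  Reference slip `w₀` (differentiable): `w₀(c₀) = 0`, floor `m|τ − c₀| ≤ |w₀|`, window
`w₀′ ≥ 3/2 + δ` on `|τ − c₀| ≤ S`, `|w₀′| ≤ Λ`, far barrier `|τ − c₀|/2 − C ≤ |w₀|` (`m, S, δ > 0`).  Perturbed slip `w` (differentiable)
with `|w − w₀| ≤ η`, `η ≤ mS/8`, and `|w′ − w₀′| ≤ η′ ≤ δ/2` everywhere.  Then `w` has a unique zero `c`, `|c − c₀| ≤ S/4`, and: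
window `w′ ≥ 3/2 + δ/2` on `|τ − c| ≤ S/2`; `|w′| ≤ Λ + η′`; floor `min(m/4, 3/2)·|τ − c| ≤ |w|`; far barrier `|τ − c|/2 − (C + η + S/8) ≤ |w|`.
[folklore] -/
theorem slipHypotheses_persist {w₀ w : ℝ → ℝ} {c₀ m S δ Λ C η η' : ℝ} (hw₀ : Differentiable ℝ w₀)
    (hw : Differentiable ℝ w) (hc₀ : w₀ c₀ = 0) (hm : 0 < m) (hS : 0 < S) (hδ : 0 < δ)
    (hfloor₀ : ∀ τ, m * |τ - c₀| ≤ |w₀ τ|) (hwin₀ : ∀ τ, |τ - c₀| ≤ S → 3 / 2 + δ ≤ deriv w₀ τ)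
    (hΛ₀ : ∀ τ, |deriv w₀ τ| ≤ Λ) (hfar₀ : ∀ τ, |τ - c₀| / 2 - C ≤ |w₀ τ|)
    (hηS : η ≤ m * S / 8) (hη' : η' ≤ δ / 2)
    (hclose : ∀ τ, |w τ - w₀ τ| ≤ η) (hclose' : ∀ τ, |deriv w τ - deriv w₀ τ| ≤ η') :
    ∃ c : ℝ, |c - c₀| ≤ S / 4 ∧ w c = 0 ∧ (∀ τ, w τ = 0 → τ = c) ∧
      (∀ τ, |τ - c| ≤ S / 2 → 3 / 2 + δ / 2 ≤ deriv w τ) ∧ (∀ τ, |deriv w τ| ≤ Λ + η') ∧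
      (∀ τ, min (m / 4) (3 / 2) * |τ - c| ≤ |w τ|) ∧ (∀ τ, |τ - c| / 2 - (C + η + S / 8) ≤ |w τ|) := by
  have hwc : Continuous w := hw.continuous
  -- the perturbed window on |τ - c₀| ≤ S
  have hwinS : ∀ τ, |τ - c₀| ≤ S → 3 / 2 + δ / 2 ≤ deriv w τ := by
    intro τ hτ
    have h1 := hwin₀ τ hτ
    have h2 := (abs_le.1 (hclose' τ)).1
    linarith
  -- pointwise comparison |w| ≥ |w₀| - η
  have hlow : ∀ τ, |w₀ τ| - η ≤ |w τ| := by
    intro τ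
    have := abs_sub_abs_le_abs_sub (w₀ τ) (w τ)
    rw [abs_sub_comm] at this
    linarith [hclose τ]
  -- signs of w₀ on the window from the linear growth at c₀
  have hlin₀ : ∀ τ, |τ - c₀| ≤ S → (3 / 2 + δ) * |τ - c₀| ≤ |w₀ τ| := fun τ hτ =>
    abs_slip_ge_linear hw₀ hc₀ hwin₀ hτ
  -- existence of the zero on [c₀ - S/4, c₀ + S/4]
  set a : ℝ := c₀ - S / 4 with ha
  set b : ℝ := c₀ + S / 4 with hb
  have hmono₀ : StrictMonoOn w₀ (Icc (c₀ - S) (c₀ + S)) := by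
    apply strictMonoOn_of_deriv_pos (convex_Icc _ _) hw₀.continuous.continuousOn
    intro x hx
    rw [interior_Icc] at hx
    have := hwin₀ x (abs_le.2 ⟨by linarith [hx.1], by linarith [hx.2]⟩)
    linarith
  have hc₀I : c₀ ∈ Icc (c₀ - S) (c₀ + S) := ⟨by linarith, by linarith⟩
  have hbI : b ∈ Icc (c₀ - S) (c₀ + S) := ⟨by rw [hb]; linarith, by rw [hb]; linarith⟩
  have haI : a ∈ Icc (c₀ - S) (c₀ + S) := ⟨by rw [ha]; linarith, by rw [ha]; linarith⟩
  have hw₀b : 0 < w₀ b := by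
    have := hmono₀ hc₀I hbI (by rw [hb]; linarith); rwa [hc₀] at this
  have hw₀a : w₀ a < 0 := by
    have := hmono₀ haI hc₀I (by rw [ha]; linarith); rwa [hc₀] at this
  have hfb : m * (S / 4) ≤ w₀ b := by
    have h := hfloor₀ b
    rw [show b - c₀ = S / 4 by rw [hb]; ring, abs_of_pos (by linarith), abs_of_pos hw₀b] at h
    exact h
  have hfa : w₀ a ≤ -(m * (S / 4)) := by
    have h := hfloor₀ a
    rw [show a - c₀ = -(S / 4) by rw [ha]; ring, abs_neg, abs_of_pos (by linarith), abs_of_neg hw₀a] at h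
    linarith
  have hwb : 0 < w b := by have := (abs_le.1 (hclose b)).1; nlinarith
  have hwa : w a < 0 := by have := (abs_le.1 (hclose a)).2; nlinarith
  obtain ⟨c, hcI, hc⟩ : ∃ c ∈ Icc a b, w c = 0 := by
    have h := intermediate_value_Icc (show a ≤ b by rw [ha, hb]; linarith) hwc.continuousOn
    exact h ⟨hwa.le, hwb.le⟩
  have hcc₀ : |c - c₀| ≤ S / 4 := abs_le.2 ⟨by rw [ha] at hcI; linarith [hcI.1], by rw [hb] at hcI; linarith [hcI.2]⟩
  -- strict monotonicity of w on the big window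
  have hmono : StrictMonoOn w (Icc (c₀ - S) (c₀ + S)) := by
    apply strictMonoOn_of_deriv_pos (convex_Icc _ _) hwc.continuousOn
    intro x hx
    rw [interior_Icc] at hx
    have := hwinS x (abs_le.2 ⟨by linarith [hx.1], by linarith [hx.2]⟩)
    linarith
  have hcI' : c ∈ Icc (c₀ - S) (c₀ + S) := ⟨by linarith [(abs_le.1 hcc₀).1], by linarith [(abs_le.1 hcc₀).2]⟩
  -- uniqueness
  have huniq : ∀ τ, w τ = 0 → τ = c := by
    intro τ hτ
    by_cases hτS : |τ - c₀| ≤ S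
    · have hτI : τ ∈ Icc (c₀ - S) (c₀ + S) := ⟨by linarith [(abs_le.1 hτS).1], by linarith [(abs_le.1 hτS).2]⟩
      exact hmono.injOn hτI hcI' (by rw [hτ, hc])
    · push Not at hτS
      have h1 := hlow τ
      have h2 := hfloor₀ τ
      rw [hτ, abs_zero] at h1
      nlinarith
  -- window about c
  have hwin : ∀ τ, |τ - c| ≤ S / 2 → 3 / 2 + δ / 2 ≤ deriv w τ := by
    intro τ hτ
    apply hwinS
    have := abs_sub_le τ c c₀
    linarith
  -- slope bound
  have hΛ : ∀ τ, |deriv w τ| ≤ Λ + η' := by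
    intro τ
    have h1 := abs_add_le (deriv w τ - deriv w₀ τ) (deriv w₀ τ)
    rw [sub_add_cancel] at h1
    linarith [hclose' τ, hΛ₀ τ]
  -- floor about c
  have hfloor : ∀ τ, min (m / 4) (3 / 2) * |τ - c| ≤ |w τ| := by
    intro τ
    have hmin1 : min (m / 4) (3 / 2) ≤ m / 4 := min_le_left _ _
    have hmin2 : min (m / 4) (3 / 2) ≤ 3 / 2 := min_le_right _ _
    have hmin0 : 0 ≤ min (m / 4) (3 / 2) := le_min (by linarith) (by norm_num)
    by_cases hτ : |τ - c| ≤ S / 2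
    · have h := abs_slip_ge_linear hw hc hwin hτ
      have : min (m / 4) (3 / 2) * |τ - c| ≤ (3 / 2 + δ / 2) * |τ - c| :=
        mul_le_mul_of_nonneg_right (by linarith) (abs_nonneg _)
      exact this.trans h
    · push Not at hτ
      have h1 := hlow τ
      have h2 := hfloor₀ τ
      have h3 : |τ - c| ≤ |τ - c₀| + S / 4 := by
        have := abs_sub_le τ c₀ c
        rw [abs_sub_comm c₀ c] at this
        linarith
      -- |w τ| ≥ m|τ - c₀| - η ≥ m|τ - c₀| - mS/8 ≥ (m/2)|τ - c₀| ≥ (m/4)|τ - c|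
      have h4 : S / 4 < |τ - c₀| := by linarith
      have h5 : m * |τ - c₀| - η ≤ |w τ| := by linarith
      have h6 : m / 4 * |τ - c| ≤ m * |τ - c₀| - η := by nlinarith
      calc min (m / 4) (3 / 2) * |τ - c| ≤ m / 4 * |τ - c| := mul_le_mul_of_nonneg_right hmin1 (abs_nonneg _)
        _ ≤ |w τ| := h6.trans h5
  -- far barrier about c
  have hfar : ∀ τ, |τ - c| / 2 - (C + η + S / 8) ≤ |w τ| := by
    intro τ
    have h1 := hlow τ
    have h2 := hfar₀ τ
    have h3 : |τ - c| ≤ |τ - c₀| + S / 4 := by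
      have := abs_sub_le τ c₀ c
      rw [abs_sub_comm c₀ c] at this
      linarith
    linarith
  exact ⟨c, hcc₀, hc, huniq, hwin, hΛ, hfloor, hfar⟩

/-! ## §2 The package along a `C¹`-small perturbation of reference slips -/

/-- **Area block near a reference family.**  Let reference slips `w⁰_j` (for each `Γ`) satisfy the package hypotheses in waist scaling
— zeros `c⁰_j`, floor `m`, window `3/2 + δ` on `|τ − c⁰_j| ≤ σ₀√Γ`, `|w⁰_j′| ≤ Λ`, far barrier `|τ − c⁰_j|/2 − c₀√Γ ≤ |w⁰_j|` everywhere —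
and let the actual slips `w_j ∈ C²` be `C¹`-close: `|w_j − w⁰_j| ≤ ε√Γ`, `|w_j′ − w⁰_j′| ≤ η′`, with `ε ≤ mσ₀/8`, `η′ ≤ δ/2`; let the curves
obey the escape clause about the reference zeros, `cg|τ − c⁰_j| ≤ Rw√Γ + ‖X_j τ‖`.  Then there is a Γ-free `KA > 0` (chosen before `Γ`) and,
for every `Γ > 0`, zeros `c_j` (`|c_j − c⁰_j| ≤ σ₀√Γ/4`) and core areas `Aa_j` with the area-law conjunct, the Γ-flat cone bound
`Rw′²Γ·Aa_j τ ≤ KA(Rw′²Γ + ‖X_j τ‖²)` for `Rw′ = Rw + cgσ₀/4`, and the floor `(Λ + η′)⁻¹ ≤ Aa_j`. [folklore] -/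
theorem slavedArea_block_of_near {N : ℕ} {δ σ₀ Λ m c₀ cg Rw ε η' : ℝ} (hδ : 0 < δ) (hσ₀ : 0 < σ₀) (hm : 0 < m)
    (hc₀ : 0 ≤ c₀) (hΛ0 : 0 ≤ Λ) (hcg : 0 < cg) (hε : 0 ≤ ε) (hεm : ε ≤ m * σ₀ / 8)
    (hη'0 : 0 ≤ η') (hη' : η' ≤ δ / 2) :
    ∃ KA : ℝ, 0 < KA ∧ ∀ Γ : ℝ, 0 < Γ →
      ∀ (w₀ w : Fin N → ℝ → ℝ) (c₀' : Fin N → ℝ) (X : Fin N → ℝ → EuclideanSpace ℝ (Fin 3)),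
        (∀ j, Differentiable ℝ (w₀ j)) → (∀ j, ContDiff ℝ 2 (w j)) → (∀ j, w₀ j (c₀' j) = 0) →
        (∀ j τ, m * |τ - c₀' j| ≤ |w₀ j τ|) → (∀ j τ, |τ - c₀' j| ≤ σ₀ * √Γ → 3 / 2 + δ ≤ deriv (w₀ j) τ) →
        (∀ j τ, |deriv (w₀ j) τ| ≤ Λ) → (∀ j τ, |τ - c₀' j| / 2 - c₀ * √Γ ≤ |w₀ j τ|) →
        (∀ j τ, |w j τ - w₀ j τ| ≤ ε * √Γ) → (∀ j τ, |deriv (w j) τ - deriv (w₀ j) τ| ≤ η') →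
        (∀ j τ, cg * |τ - c₀' j| ≤ Rw * √Γ + ‖X j τ‖) →
        ∃ (c : Fin N → ℝ) (Aa : Fin N → ℝ → ℝ),
          (∀ j, |c j - c₀' j| ≤ σ₀ * √Γ / 4 ∧ w j (c j) = 0 ∧ ∀ τ, w j τ = 0 → τ = c j) ∧
          (∀ j, Differentiable ℝ (Aa j) ∧ (∀ τ, 0 < Aa j τ) ∧
            ∀ τ, w j τ * deriv (Aa j) τ = (3 / 2 - deriv (w j) τ) * Aa j τ + 4) ∧
          (∀ j τ, (Rw + cg * σ₀ / 4) ^ 2 * Γ * Aa j τ ≤ KA * ((Rw + cg * σ₀ / 4) ^ 2 * Γ + ‖X j τ‖ ^ 2)) ∧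
          (∀ j τ, (Λ + η')⁻¹ ≤ Aa j τ) := by
  -- the perturbed constants
  have hδ2 : 0 < δ / 2 := by linarith
  have hσ2 : 0 < σ₀ / 2 := by linarith
  have hm' : 0 < min (m / 4) (3 / 2) := lt_min (by linarith) (by norm_num)
  have hc₀' : 0 ≤ c₀ + ε + σ₀ / 8 := by positivity
  set σ₁ : ℝ := max (σ₀ / 2) (2 * (c₀ + ε + σ₀ / 8) + 2) with hσ₁
  have hσ₁ge : σ₀ / 2 ≤ σ₁ := le_max_left _ _
  have hu : 0 < σ₁ / 2 - (c₀ + ε + σ₀ / 8) := by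
    have := le_max_right (σ₀ / 2) (2 * (c₀ + ε + σ₀ / 8) + 2); rw [← hσ₁] at this; linarith
  have hΛ' : 0 ≤ Λ + η' := by positivity
  obtain ⟨KA, hKA, hblock⟩ := slavedArea_block (N := N) (Rw := Rw + cg * σ₀ / 4) hδ2 hσ2 hσ₁ge hm' hc₀' hu hΛ' hcg
  refine ⟨KA, hKA, ?_⟩
  intro Γ hΓ w₀ w c₀' X hw₀ hw hz hfloor₀ hwin₀ hΛ₀ hfar₀ hclose hclose' hesc
  have hsq : 0 < √Γ := Real.sqrt_pos.2 hΓ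
  have hS : 0 < σ₀ * √Γ := mul_pos hσ₀ hsq
  -- persistence, filament by filament
  have hper : ∀ j, ∃ c : ℝ, |c - c₀' j| ≤ σ₀ * √Γ / 4 ∧ w j c = 0 ∧ (∀ τ, w j τ = 0 → τ = c) ∧
      (∀ τ, |τ - c| ≤ σ₀ * √Γ / 2 → 3 / 2 + δ / 2 ≤ deriv (w j) τ) ∧ (∀ τ, |deriv (w j) τ| ≤ Λ + η') ∧
      (∀ τ, min (m / 4) (3 / 2) * |τ - c| ≤ |w j τ|) ∧
      (∀ τ, |τ - c| / 2 - (c₀ * √Γ + ε * √Γ + σ₀ * √Γ / 8) ≤ |w j τ|) := by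
    intro j
    exact slipHypotheses_persist (hw₀ j) ((hw j).differentiable two_ne_zero) (hz j) hm hS hδ (hfloor₀ j) (hwin₀ j)
      (hΛ₀ j) (hfar₀ j) (by nlinarith [hsq.le]) hη' (hclose j) (hclose' j)
  choose c hcnear hcz hcuniq hcwin hcΛ hcfloor hcfar using hper
  -- the package at the perturbed constants
  have hsup' : ∀ j s, |s - c j| ≤ σ₀ / 2 * √Γ → 3 / 2 + δ / 2 ≤ deriv (w j) s :=
    fun j s hs => hcwin j s (by linarith)
  have hfar' : ∀ j τ, σ₁ * √Γ ≤ |τ - c j| → |τ - c j| / 2 - (c₀ + ε + σ₀ / 8) * √Γ ≤ |w j τ| := by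
    intro j τ _
    have := hcfar j τ
    have e : (c₀ + ε + σ₀ / 8) * √Γ = c₀ * √Γ + ε * √Γ + σ₀ * √Γ / 8 := by ring
    rw [e]; exact this
  have hesc' : ∀ j τ, cg * |τ - c j| ≤ (Rw + cg * σ₀ / 4) * √Γ + ‖X j τ‖ := by
    intro j τ
    have h1 := hesc j τ
    have h2 : |τ - c j| ≤ |τ - c₀' j| + σ₀ * √Γ / 4 := by
      have := abs_sub_le τ (c₀' j) (c j)
      rw [abs_sub_comm (c₀' j) (c j)] at this
      linarith [hcnear j]
    have h3 : cg * |τ - c j| ≤ cg * |τ - c₀' j| + cg * (σ₀ * √Γ / 4) := by nlinarith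
    calc cg * |τ - c j| ≤ cg * |τ - c₀' j| + cg * (σ₀ * √Γ / 4) := h3
      _ ≤ Rw * √Γ + ‖X j τ‖ + cg * (σ₀ * √Γ / 4) := by linarith
      _ = (Rw + cg * σ₀ / 4) * √Γ + ‖X j τ‖ := by ring
  obtain ⟨Aa, hAa, hcone, hfl, -⟩ := hblock Γ hΓ w c X hw hcz hcuniq hsup' hcΛ hcfloor hfar' hesc'
  exact ⟨c, Aa, fun j => ⟨hcnear j, hcz j, hcuniq j⟩, hAa, hcone, hfl⟩

end Summit.NavierStokesRegularity.NavierStokesRegularity.Theorems.AreaLawSlaving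

end
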